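import Summits.QuantumFields.YangMills.Theorems.LuscherReductionDressedRitzPolyakovLiftSlabTrunc
import HarnessLib

/-!
# Route `LuscherReduction`, item `DressedRitz` (stmt-QuantumFields-20205), line «polyakovlift» r5 — S-UNIV′ from TRUNCATED finite-slab correlators:
# `SlabTruncChannelUniversalityAt k ⟹ EuclideanChannelUniversalityAt k ⟹ ChannelUniversalityAt k`

Support module (LEAD prover ym-lead-20205-polyakovlift g0; `--supports stmt-QuantumFields-20205`, helper).  The `slabCorr` version
(`…PolyakovLiftSlabChannelUniversality`) subtracts vacuum one-point constants inside finite slabs; this version uses the slab's own truncation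
(`slabTrunc = R_M(G_i,G_l) − R_M(G_i,1)·R_M(1,G_l)`, `…PolyakovLiftSlabTrunc`, `tendsto_slabTrunc`), so the HYPOTHESIS `SlabTruncChannelUniversalityAt k`
mentions no vacuum vector and no top eigenvalue at all — only ratios of free-boundary slab path integrals on `L³ × (2M + t)`, `t ∈ {2L, 2L+1}`, for the
fine theory and for the one-site model, uniformly in `M ≥ M₀`.  (The raw vacua still appear in the quantifier frame, unused by the clauses, to keep the
frame identical to `EuclideanChannelUniversalityAt`.)

* `SlabTruncChannelUniversalityAt k`; ★ `euclideanChannelUniversality_of_slabTrunc`; ★ `channelUniversality_of_slabTrunc`.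

HONEST FRAMING: fixed-lattice functional analysis on the conditional femto rung R2b1; S-UNIV′ stays OPEN; nothing here bears on infinite volume, the
continuum limit or the Clay gap.  References: E. Seiler, LNP 159 §3 [cite: SeilerLNP1982, §3]; Lüscher–Wolff [cite: LuscherWolff1990].
-/

set_option autoImplicit false

noncomputable section

open MeasureTheory Filter Topology Real
open Literature.MathematicalPhysics.QuantumFieldTheory (GaugeConfig Site gaugeTransform)
open scoped BigOperators

namespace Summit.QuantumFields.YangMills.Theorems.FemtoTransferGap.PolyakovLift

open Summit.QuantumFields.YangMills.Theorems.FemtoTransferGap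

/-! ## §1 The truncated finite-slab form of S-UNIV′ (no vacuum data in the hypothesis) -/

/-- **`SlabTruncChannelUniversalityAt k`** — (E5)/(E6′) of `EuclideanChannelUniversalityAt k` with every normalised connected correlator replaced by the TRUNCATED slab
correlator `slabTrunc … M` (no vacuum constants) (fine side at `β` on the `L`-lattice, one-site side at `B = oneSiteCoupling β L`, insertions `flowLiftAt 0 (flowTime β L) g_i` resp.
`g_i ∘ powLink L`, separations `2m, 2m+1`, `m = dressSteps L`), asserted for all slab parameters `M ≥ M₀`. [cite: LuscherWolff1990] -/
def SlabTruncChannelUniversalityAt (k : ℕ) : Prop :=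
  ∃ C lam0 : ℝ, 0 ≤ C ∧ 0 < lam0 ∧ ∀ lam : ℝ, 0 < lam → lam ≤ lam0 → ∃ L0 : ℕ,
    ∀ (L : ℕ) [NeZero L], L0 ≤ L → ∀ β : ℝ, InFemtoWindow lam β L →
      ∀ φ : GaugeConfig 3 L SU2 → ℝ, IsRawVacuum β φ →
        ∀ (ω : GaugeConfig 3 1 SU2 → ℝ) (g : Fin k → (GaugeConfig 3 1 SU2 → ℝ)), LiftBasis (liftCoupling β L) k ω g →
          ∀ e₀ : GaugeConfig 3 1 SU2 → ℝ, IsRawVacuum (L := 1) (oneSiteCoupling β L) e₀ →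
            let sF := slabTrunc β (fun i => flowLiftAt (L := L) 0 (flowTime β L) (g i))
            let sO := slabTrunc (oneSiteCoupling β L) (fun i => g i ∘ powLink L)
            let m := dressSteps L
            ∃ M0 : ℕ, ∀ M : ℕ, M0 ≤ M →
              (∀ i : Fin k,
                sF (2 * m + 1) i i M * sO (2 * m) i i M ≤
                    Real.exp (C * luscherLambda β L ^ 2 / L) * (sO (2 * m + 1) i i M * sF (2 * m) i i M) ∧
                sO (2 * m + 1) i i M * sF (2 * m) i i M ≤
                    Real.exp (C * luscherLambda β L ^ 2 / L) * (sF (2 * m + 1) i i M * sO (2 * m) i i M)) ∧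
              (∀ i l : Fin k, i ≠ l →
                |(sF (2 * m + 1) i l M -
                      (sF (2 * m + 1) i i M / sF (2 * m) i i M + sF (2 * m + 1) l l M / sF (2 * m) l l M) / 2 * sF (2 * m) i l M) *
                    (Real.sqrt (sO (2 * m) i i M) * Real.sqrt (sO (2 * m) l l M)) -
                  (sO (2 * m + 1) i l M -
                      (sO (2 * m + 1) i i M / sO (2 * m) i i M + sO (2 * m + 1) l l M / sO (2 * m) l l M) / 2 * sO (2 * m) i l M) *
                    (Real.sqrt (sF (2 * m) i i M) * Real.sqrt (sF (2 * m) l l M))|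
                  ≤ C * (luscherLambda β L ^ 2 / L) *
                    (Real.sqrt (sF (2 * m) i i M) * Real.sqrt (sF (2 * m) l l M)) *
                      (Real.sqrt (sO (2 * m) i i M) * Real.sqrt (sO (2 * m) l l M)))

/-! ## §3 ★ Slab ⟹ Euclidean ⟹ channel form -/

/-- ★★ **`SlabTruncChannelUniversalityAt k → EuclideanChannelUniversalityAt k`** (same `C`, same `lam0`; `L0` raised to `≥ 1`): pass to the limit `M → ∞` in every
clause (`tendsto_slabTrunc`); the denominators' limits are positive by (o0) for every lift basis on both sides. [cite: SeilerLNP1982, §3] -/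
theorem euclideanChannelUniversality_of_slabTrunc {k : ℕ} (h : SlabTruncChannelUniversalityAt k) : EuclideanChannelUniversalityAt k := by
  obtain ⟨C, lam0, hC, hlam0, hk⟩ := h
  refine ⟨C, lam0, hC, hlam0, fun lam hlam hle => ?_⟩
  obtain ⟨L0, hL⟩ := hk lam hlam hle
  refine ⟨max L0 1, fun L _ hL0 β hW φ hφ ω g hbasis e₀ he₀ => ?_⟩
  obtain ⟨M0, hM⟩ := hL L ((le_max_left _ _).trans hL0) β hW φ hφ ω g hbasis e₀ he₀
  have hLpos : 0 < L := lt_of_lt_of_le zero_lt_one ((le_max_right _ _).trans hL0)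
  have hβ : 0 < β := zero_lt_one.trans_le hW.1
  have hΛpos : 0 < luscherLambda β L := luscherLambda_pos_of_window hlam hW
  have hLr : (0 : ℝ) < L := Nat.cast_pos.mpr hLpos
  have hBpos : 0 < oneSiteCoupling β L := by
    unfold oneSiteCoupling; exact div_pos (mul_pos two_pos (pow_pos hLr 3)) (pow_pos hΛpos 3)
  have hB1pos : 0 < liftCoupling β L := by
    unfold liftCoupling; exact div_pos two_pos (pow_pos hΛpos 3)
  set m := dressSteps L with hm
  set G : Fin k → (GaugeConfig 3 L SU2 → ℝ) := fun i => flowLiftAt (L := L) 0 (flowTime β L) (g i) with hG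
  set S : Fin k → (GaugeConfig 3 1 SU2 → ℝ) := fun i => g i ∘ powLink L with hS
  have hg : ∀ i, IsPhys (g i) := hbasis.2.2.2.2.1
  have hGi : ∀ i, IsPhys (G i) := fun i => isPhys_flowLiftAt 0 _ (hg i)
  have hSi : ∀ i, IsPhys (S i) := fun i => isPhys_comp_powLink L (hg i)
  -- the limits
  have TF : ∀ (t : ℕ) (i l : Fin k), Tendsto (slabTrunc β G t i l) atTop (𝓝 (corr β φ G t i l)) :=
    fun t i l => tendsto_slabTrunc hβ hφ hGi t i l
  have TO : ∀ (t : ℕ) (i l : Fin k),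
      Tendsto (slabTrunc (oneSiteCoupling β L) S t i l) atTop (𝓝 (corr (oneSiteCoupling β L) e₀ S t i l)) :=
    fun t i l => tendsto_slabTrunc hBpos he₀ hSi t i l
  -- positivity of the limiting Gram numbers ((o0) for every lift basis, both sides)
  have hl0pos : 0 < levelValue su2Rep L β 0 := levelValue_su2Rep_pos hβ 0
  have hm0pos : 0 < levelValue su2Rep 1 (oneSiteCoupling β L) 0 := levelValue_su2Rep_pos (L := 1) hBpos 0
  have hcF0 : ∀ i : Fin k, 0 < corr β φ G (2 * m) i i := fun i => by
    have h := liftBasis_dressed_o0 hβ hφ hB1pos hbasis 0 (flowTime β L) m i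
    rw [corr_dressed_norm hβ hφ.1 hGi m i i] at h
    exact pos_of_mul_pos_right h (pow_nonneg hl0pos.le _)
  have hcO0 : ∀ i : Fin k, 0 < corr (oneSiteCoupling β L) e₀ S (2 * m) i i := fun i => by
    have h := shadowFamily_o0 hBpos hB1pos hLpos he₀ hbasis i
    simp only [shadowFamily, shadowVec] at h
    rw [corr_dressed_norm hBpos he₀.1 hSi m i i] at h
    exact pos_of_mul_pos_right h (pow_nonneg hm0pos.le _)
  have hev : ∀ᶠ M in atTop, M0 ≤ M := eventually_ge_atTop M0
  refine ⟨fun i => ⟨?_, ?_⟩, fun i l hil => ?_⟩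
  · refine le_of_tendsto_of_tendsto ((TF _ i i).mul (TO _ i i)) (((TO _ i i).mul (TF _ i i)).const_mul _) ?_
    exact hev.mono fun M hMM => ((hM M hMM).1 i).1
  · refine le_of_tendsto_of_tendsto ((TO _ i i).mul (TF _ i i)) (((TF _ i i).mul (TO _ i i)).const_mul _) ?_
    exact hev.mono fun M hMM => ((hM M hMM).1 i).2
  · have TsF : Tendsto (fun M => Real.sqrt (slabTrunc β G (2 * m) i i M) * Real.sqrt (slabTrunc β G (2 * m) l l M)) atTop
        (𝓝 (Real.sqrt (corr β φ G (2 * m) i i) * Real.sqrt (corr β φ G (2 * m) l l))) :=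
      (TF _ i i).sqrt.mul (TF _ l l).sqrt
    have TsO : Tendsto (fun M => Real.sqrt (slabTrunc (oneSiteCoupling β L) S (2 * m) i i M) *
          Real.sqrt (slabTrunc (oneSiteCoupling β L) S (2 * m) l l M)) atTop
        (𝓝 (Real.sqrt (corr (oneSiteCoupling β L) e₀ S (2 * m) i i) * Real.sqrt (corr (oneSiteCoupling β L) e₀ S (2 * m) l l))) :=
      (TO _ i i).sqrt.mul (TO _ l l).sqrt
    have TAF : Tendsto (fun M => slabTrunc β G (2 * m + 1) i l M -
          (slabTrunc β G (2 * m + 1) i i M / slabTrunc β G (2 * m) i i M +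
              slabTrunc β G (2 * m + 1) l l M / slabTrunc β G (2 * m) l l M) / 2 * slabTrunc β G (2 * m) i l M) atTop
        (𝓝 (corr β φ G (2 * m + 1) i l -
          (corr β φ G (2 * m + 1) i i / corr β φ G (2 * m) i i + corr β φ G (2 * m + 1) l l / corr β φ G (2 * m) l l) / 2 *
            corr β φ G (2 * m) i l)) :=
      (TF _ i l).sub ((((TF _ i i).div (TF _ i i) (hcF0 i).ne').add ((TF _ l l).div (TF _ l l) (hcF0 l).ne')).div_const 2 |>.mul
        (TF _ i l))
    have TAO : Tendsto (fun M => slabTrunc (oneSiteCoupling β L) S (2 * m + 1) i l M -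
          (slabTrunc (oneSiteCoupling β L) S (2 * m + 1) i i M / slabTrunc (oneSiteCoupling β L) S (2 * m) i i M +
              slabTrunc (oneSiteCoupling β L) S (2 * m + 1) l l M / slabTrunc (oneSiteCoupling β L) S (2 * m) l l M) / 2 *
            slabTrunc (oneSiteCoupling β L) S (2 * m) i l M) atTop
        (𝓝 (corr (oneSiteCoupling β L) e₀ S (2 * m + 1) i l -
          (corr (oneSiteCoupling β L) e₀ S (2 * m + 1) i i / corr (oneSiteCoupling β L) e₀ S (2 * m) i i +
              corr (oneSiteCoupling β L) e₀ S (2 * m + 1) l l / corr (oneSiteCoupling β L) e₀ S (2 * m) l l) / 2 *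
            corr (oneSiteCoupling β L) e₀ S (2 * m) i l)) :=
      (TO _ i l).sub ((((TO _ i i).div (TO _ i i) (hcO0 i).ne').add ((TO _ l l).div (TO _ l l) (hcO0 l).ne')).div_const 2 |>.mul
        (TO _ i l))
    refine le_of_tendsto_of_tendsto (((TAF.mul TsO).sub (TAO.mul TsF)).abs) ((TsF.const_mul _).mul TsO) ?_
    exact hev.mono fun M hMM => (hM M hMM).2 i l hil

/-- ★ **`SlabTruncChannelUniversalityAt k → ChannelUniversalityAt k`** — the registered stub S-UNIV′ from the finite-slab statement. [cite: LuscherWolff1990] -/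
theorem channelUniversality_of_slabTrunc {k : ℕ} (h : SlabTruncChannelUniversalityAt k) : ChannelUniversalityAt k :=
  channelUniversality_of_euclidean (euclideanChannelUniversality_of_slabTrunc h)

end Summit.QuantumFields.YangMills.Theorems.FemtoTransferGap.PolyakovLift

end
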